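import Mathlib
import Literature.Analysis.FluidPDE.Tao2016AveragedNS.BoundedEternalSolutions
import HarnessLib

/-!
# The FED-SPIKE inequality and the SHELL STEP for admissible eternal solutions of the
# renormalised lattice (support for `WakeRatchet.AdmissibleEternalBound`, stmt-NavierStokesRegularity-23197)

The crux `AdmissibleEternalBound` (split child (A) of the shared K2ᵛ `EternalRigidityViscBddOne`)
asserts that every admissible eternal solution (`IsEternalVisc ε₀ ν̂ α W`: the shell-wise renormalised
lattice law with covariant viscosity `ν̂ ≥ 0`, a UNIFORM per-shell action bound `∫‖W_n‖ ≤ M`, and a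
per-shell forward energy bound) of an E₂(R) table is `UniformBound`.  Its informal LEVER is the «fed
spike»: a tall value of shell `k` must be fed, within log-time `O(1)`, by shell `k − 1`.  This file
proves the rigorous form of that lever and shows exactly how far it carries.

* `gronwall_sq_fence` — a real-variable Grönwall lemma in fencing form for `h²`
  (`image_le_of_deriv_right_lt_deriv_boundary`), avoiding derivatives of a norm at its zeros.
* `renE_deriv_le` — on a cancelling table the renormalised shell energy `ẽ_k = e^{2σ}‖W_k‖²`
  (`hasDerivAt_renE`: the intra-shell field is invisible, the back-reaction pairing equals minus the
  outgoing flux pairing by (4.3)) has `ẽ_k' ≤ 2(e^{σ}‖W_k‖)(ΛC_A e^{σ}‖W_{k-1}‖²) + 2C_AΛ⁻¹‖W_{k+1}‖ẽ_k`.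
* `fedSpike` — THE FED-SPIKE INEQUALITY: for `a ≤ b`,
  `e^{b}‖W_k(b)‖ ≤ exp(C_AΛ⁻¹∫_a^b‖W_{k+1}‖)(e^{a}‖W_k(a)‖ + ΛC_A∫_a^b e^{s}‖W_{k-1}(s)‖² ds)`.
* `shellStep` — THE SHELL STEP on left half-lines: with per-shell action `≤ M`, `‖W_k‖ ≤ S` on
  `(-∞, σ₀]` implies `‖W_{k+1}‖ ≤ K·S` on `(-∞, σ₀]`, `K = ΛC_A M e^{C_A M/Λ}` (the FED-SPIKE FACTOR).

What this says about the crux: the lever controls shell `k+1` by shell `k` with a factor `K ≥ 1`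
unless the action is small (critic P1 on stmt-23197); the companion file
`WakeRatchetAdmissibleEternalBoundSmallAction` has the iterate, the small-action Liouville theorem
`UniformBound ∧ K < 1 ⇒ W ≡ 0` and the kill criterion; uniformity in the shell index does NOT follow.

HONEST FRAMING: MODEL lattice ODEs only (Tao 2016 §4, §6.4); nothing in this file is a statement
about the Navier–Stokes equations, and no summit or rung is proved by it.
-/

noncomputable section

set_option linter.dupNamespace false

namespace Summit.NavierStokesRegularity.NavierStokesRegularity.Theorems

namespace WakeRatchetFedSpike

open Filter Topology MeasureTheory Set intervalIntegral
open scoped RealInnerProductSpace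
open Literature.Analysis.FluidPDE Literature.Analysis.FluidPDE.TaoCascade

/-! ## Real-variable helpers -/

/-- An integrable real function is smaller than any positive level somewhere on every left
half-line (a left half-line has infinite Lebesgue measure). [folklore] -/
theorem exists_le_abs_lt {u : ℝ → ℝ} (hu : Integrable u) {η : ℝ} (hη : 0 < η) (σ : ℝ) :
    ∃ a, a ≤ σ ∧ |u a| < η := by
  by_contra h
  push Not at h
  have hsub : Iic σ ⊆ {x | η ≤ ‖u x‖} := fun x hx => by
    simpa [Real.norm_eq_abs] using h x hx
  have hfin := hu.measure_norm_ge_lt_top hη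
  have hlt : volume (Iic σ) < ⊤ := lt_of_le_of_lt (measure_mono hsub) hfin
  simp [Real.volume_Iic] at hlt

/-- An interval integral of a nonnegative integrable function is at most its integral over `ℝ`.
[folklore] -/
theorem intervalIntegral_le_integral {u : ℝ → ℝ} (hu : Integrable u) (hu_nn : ∀ x, 0 ≤ u x)
    {a b : ℝ} (hab : a ≤ b) : ∫ s in a..b, u s ≤ ∫ s, u s := by
  rw [integral_of_le hab]
  exact setIntegral_le_integral hu (ae_of_all _ hu_nn)

/-! ## A Grönwall lemma in fencing form -/

/-- **Grönwall lemma for `h²` (fencing form).**  If `h ≥ 0`, `h²` is differentiable with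
derivative `D`, and `D ≤ 2 h · src + 2 κ · cof · h²` with continuous `src, cof ≥ 0` and `κ ≥ 0`, then
`h(b) ≤ exp(κ ∫_a^b cof) · (h(a) + ∫_a^b src)` for `a ≤ b`.  (Proof: fence `h²` under the square of
`(h(a) + ∫_a^x src + η(1 + x − a)) · exp(κ ∫_a^x cof)` with `image_le_of_deriv_right_lt_deriv_boundary`,
then `η → 0⁺`.)  Working with `h²` rather than `h` avoids differentiating a norm at its zeros.
[folklore] -/
theorem gronwall_sq_fence {h D src cof : ℝ → ℝ} {κ a b : ℝ} (hab : a ≤ b) (hκ : 0 ≤ κ)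
    (hh0 : ∀ x, 0 ≤ h x) (hE : ∀ x, HasDerivAt (fun x => h x ^ 2) (D x) x)
    (hD : ∀ x, D x ≤ 2 * h x * src x + 2 * κ * cof x * h x ^ 2)
    (hsrc_c : Continuous src) (hcof_c : Continuous cof)
    (hsrc0 : ∀ s, 0 ≤ src s) (hcof0 : ∀ s, 0 ≤ cof s) :
    h b ≤ Real.exp (κ * ∫ s in a..b, cof s) * (h a + ∫ s in a..b, src s) := by
  set E : ℝ → ℝ := fun x => h x ^ 2 with hEdef
  have hEc : Continuous E := continuous_iff_continuousAt.2 fun x => (hE x).continuousAt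
  -- primitives of the source and of the coefficient
  set F : ℝ → ℝ := fun x => ∫ s in a..x, src s with hFdef
  set I : ℝ → ℝ := fun x => ∫ s in a..x, cof s with hIdef
  have hFd : ∀ x, HasDerivAt F (src x) x := fun x =>
    intervalIntegral.integral_hasDerivAt_right (hsrc_c.intervalIntegrable _ _)
      (hsrc_c.stronglyMeasurableAtFilter _ _) hsrc_c.continuousAt
  have hId : ∀ x, HasDerivAt I (cof x) x := fun x =>
    intervalIntegral.integral_hasDerivAt_right (hcof_c.intervalIntegrable _ _)
      (hcof_c.stronglyMeasurableAtFilter _ _) hcof_c.continuousAt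
  have hF0 : ∀ x, a ≤ x → 0 ≤ F x := fun x hx =>
    intervalIntegral.integral_nonneg hx fun s _ => hsrc0 s
  have hI0 : ∀ x, a ≤ x → 0 ≤ I x := fun x hx =>
    intervalIntegral.integral_nonneg hx fun s _ => hcof0 s
  have hFa : F a = 0 := by simp only [hFdef, intervalIntegral.integral_same]
  have hIa : I a = 0 := by simp only [hIdef, intervalIntegral.integral_same]
  set c₀ : ℝ := h a with hc₀def
  have hc₀ : 0 ≤ c₀ := hh0 a
  -- the fence, for every `η > 0`
  have key : ∀ η : ℝ, 0 < η → h b ≤ (c₀ + F b + η * (1 + (b - a))) * Real.exp (κ * I b) := by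
    intro η hη
    set B : ℝ → ℝ := fun x => (c₀ + F x + η * (1 + (x - a))) * Real.exp (κ * I x) with hBdef
    set B' : ℝ → ℝ := fun x => (src x + η) * Real.exp (κ * I x)
        + (c₀ + F x + η * (1 + (x - a))) * (Real.exp (κ * I x) * (κ * cof x)) with hB'def
    have hBd : ∀ x, HasDerivAt B (B' x) x := by
      intro x
      have hlin : HasDerivAt (fun x : ℝ => η * (1 + (x - a))) (η * 1) x := by
        have h1 : HasDerivAt (fun x : ℝ => 1 + (x - a)) 1 x := by
          have := ((hasDerivAt_id x).sub_const a).const_add 1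
          simpa using this
        exact h1.const_mul η
      have hA : HasDerivAt (fun x => c₀ + F x) (src x) x := by
        have := (hFd x).const_add c₀
        simpa using this
      have h1 : HasDerivAt (fun x => c₀ + F x + η * (1 + (x - a))) (src x + η) x := by
        have := hA.add hlin
        rw [mul_one] at this
        exact this
      have h2 : HasDerivAt (fun x => Real.exp (κ * I x)) (Real.exp (κ * I x) * (κ * cof x)) x :=
        ((hId x).const_mul κ).exp
      exact h1.mul h2
    have hlinpos : ∀ x, a ≤ x → 0 < c₀ + F x + η * (1 + (x - a)) := by
      intro x hx
      have := hF0 x hx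
      nlinarith
    have hBpos : ∀ x, a ≤ x → 0 < B x := fun x hx => mul_pos (hlinpos x hx) (Real.exp_pos _)
    -- at `a`
    have ha : E a ≤ B a * B a := by
      have hBa : B a = c₀ + η := by
        simp only [hBdef, hFa, hIa, sub_self, add_zero, mul_one, mul_zero, Real.exp_zero]
      rw [hBa]
      simp only [hEdef]
      rw [← hc₀def]
      nlinarith
    -- the strict derivative inequality at touching points
    have bound : ∀ x ∈ Ico a b, E x = B x * B x → D x < B' x * B x + B x * B' x := by
      intro x hx hEx
      have hBx := hBpos x hx.1
      have hroot : h x = B x := by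
        have h1 : (h x) ^ 2 = (B x) ^ 2 := by rw [sq (B x), ← hEx]
        have := congrArg Real.sqrt h1
        rwa [Real.sqrt_sq (hh0 x), Real.sqrt_sq hBx.le] at this
      have hDx := hD x
      rw [hroot] at hDx
      have hexpI : 1 ≤ Real.exp (κ * I x) := Real.one_le_exp (mul_nonneg hκ (hI0 x hx.1))
      -- `B' x ≥ (src x + η) + κ cof x · B x`
      have hB'ge : src x + η + κ * cof x * B x ≤ B' x := by
        have t1 : src x + η ≤ (src x + η) * Real.exp (κ * I x) := by
          have := mul_le_mul_of_nonneg_left hexpI (add_nonneg (hsrc0 x) hη.le)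
          simpa using this
        have t2 : κ * cof x * B x
            = (c₀ + F x + η * (1 + (x - a))) * (Real.exp (κ * I x) * (κ * cof x)) := by
          simp only [hBdef]; ring
        simp only [hB'def]
        linarith
      have : 2 * B x * src x + 2 * κ * cof x * B x ^ 2 < B' x * B x + B x * B' x := by
        nlinarith [mul_le_mul_of_nonneg_left hB'ge hBx.le]
      linarith
    have hfence := image_le_of_deriv_right_lt_deriv_boundary (f := E) (f' := D) (a := a) (b := b)
      hEc.continuousOn (fun x _ => (hE x).hasDerivWithinAt)
      (B := fun x => B x * B x) (B' := fun x => B' x * B x + B x * B' x) ha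
      (fun x => (hBd x).mul (hBd x)) bound
    have hEb : E b ≤ B b * B b := hfence ⟨hab, le_rfl⟩
    have hBb : 0 < B b := hBpos b hab
    have hfin : h b ≤ B b := by
      have h1 : (h b) ^ 2 ≤ (B b) ^ 2 := by rw [sq (B b)]; exact hEb
      have := Real.sqrt_le_sqrt h1
      rwa [Real.sqrt_sq (hh0 b), Real.sqrt_sq hBb.le] at this
    simpa only [hBdef] using hfin
  -- let `η → 0⁺`
  have hlim : h b ≤ (c₀ + F b) * Real.exp (κ * I b) := by
    refine le_of_forall_pos_lt_add fun δ hδ => ?_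
    have hX : 0 < (1 + (b - a)) * Real.exp (κ * I b) := by
      have : 0 < 1 + (b - a) := by linarith
      positivity
    set X : ℝ := (1 + (b - a)) * Real.exp (κ * I b) with hXdef
    have hkey := key (δ / (2 * X)) (by positivity)
    have hsplit : (c₀ + F b + δ / (2 * X) * (1 + (b - a))) * Real.exp (κ * I b)
        = (c₀ + F b) * Real.exp (κ * I b) + δ / (2 * X) * X := by rw [hXdef]; ring
    have hsmall : δ / (2 * X) * X = δ / 2 := by
      field_simp
    linarith
  calc h b ≤ (c₀ + F b) * Real.exp (κ * I b) := hlim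
    _ = Real.exp (κ * ∫ s in a..b, cof s) * (h a + ∫ s in a..b, src s) := by
        rw [hc₀def]; ring

/-! ## The fed-spike inequality -/

section FedSpike

variable {m : ℕ} {ε₀ νh : ℝ} {α : Fin m → Fin m → Fin m → ℤ × ℤ × ℤ → ℝ} {W : ℤ → ℝ → Em m}

/-- **Derivative bound for the renormalised shell energy.**  On a cancelling table, for an
admissible eternal solution with covariant viscosity `ν̂ ≥ 0`, the derivative of
`ẽ_k = e^{2σ}‖W_k‖²` (`hasDerivAt_renE`) is at most
`2 (e^{σ}‖W_k‖) · (Λ C_A e^{σ}‖W_{k-1}‖²) + 2 (C_A Λ⁻¹) ‖W_{k+1}‖ · ẽ_k`: the intra-shell field is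
invisible, the feed is quadratic in the shell below, the back-reaction pairing is linear in `ẽ_k`
with coefficient `‖W_{k+1}‖`, and dissipation only helps.
[cite: Tao2016AveragedNS, §4 Lemma 4.1 (4.8)–(4.10) with the cancellation (4.3), shell-wise in the self-similar variables of §6.4; cell vocabulary (`IsEternalVisc`)] -/
theorem renE_deriv_le (hε : 0 < ε₀) (hc : IsCancellingCoeff α) (hW : IsEternalVisc ε₀ νh α W)
    (k : ℤ) (σ : ℝ) :
    Real.exp (2 * σ) * (2 * bigLam ε₀ * ⟪W k σ, tableA α (W (k - 1) σ)⟫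
        - 2 * (bigLam ε₀)⁻¹ * ⟪W (k + 1) σ, tableA α (W k σ)⟫
        - 2 * viscCoef ε₀ νh k σ * ‖W k σ‖ ^ 2)
      ≤ 2 * (Real.exp σ * ‖W k σ‖) * (bigLam ε₀ * fluxConst α * (Real.exp σ * ‖W (k - 1) σ‖ ^ 2))
        + 2 * (fluxConst α * (bigLam ε₀)⁻¹) * ‖W (k + 1) σ‖ * (Real.exp σ * ‖W k σ‖) ^ 2 := by
  have hS := table_sTable α hc
  have hΛpos : 0 < bigLam ε₀ := bigLam_pos (by linarith)
  have hΛi : 0 ≤ (bigLam ε₀)⁻¹ := inv_nonneg.2 hΛpos.le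
  have hCA : 0 ≤ fluxConst α := hS.CA_nonneg
  have hin1 : |⟪W k σ, tableA α (W (k - 1) σ)⟫| ≤ ‖W k σ‖ * (fluxConst α * ‖W (k - 1) σ‖ ^ 2) :=
    (abs_real_inner_le_norm _ _).trans (mul_le_mul_of_nonneg_left (hS.normA _) (norm_nonneg _))
  have hin2 : |⟪W (k + 1) σ, tableA α (W k σ)⟫| ≤ ‖W (k + 1) σ‖ * (fluxConst α * ‖W k σ‖ ^ 2) :=
    (abs_real_inner_le_norm _ _).trans (mul_le_mul_of_nonneg_left (hS.normA _) (norm_nonneg _))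
  have hvisc : 0 ≤ viscCoef ε₀ νh k σ := by
    unfold viscCoef; exact mul_nonneg hW.nonneg (by positivity)
  have h1 : 2 * bigLam ε₀ * ⟪W k σ, tableA α (W (k - 1) σ)⟫
      ≤ 2 * bigLam ε₀ * (‖W k σ‖ * (fluxConst α * ‖W (k - 1) σ‖ ^ 2)) :=
    mul_le_mul_of_nonneg_left ((le_abs_self _).trans hin1) (by positivity)
  have h2 : -(2 * (bigLam ε₀)⁻¹ * ⟪W (k + 1) σ, tableA α (W k σ)⟫)
      ≤ 2 * (bigLam ε₀)⁻¹ * (‖W (k + 1) σ‖ * (fluxConst α * ‖W k σ‖ ^ 2)) := by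
    have := neg_abs_le ⟪W (k + 1) σ, tableA α (W k σ)⟫
    nlinarith
  have h3 : 0 ≤ 2 * viscCoef ε₀ νh k σ * ‖W k σ‖ ^ 2 := by positivity
  have hexp : 0 < Real.exp (2 * σ) := Real.exp_pos _
  have hexp2 : Real.exp (2 * σ) = Real.exp σ * Real.exp σ := by
    rw [show (2 : ℝ) * σ = σ + σ by ring, Real.exp_add]
  calc Real.exp (2 * σ) * (2 * bigLam ε₀ * ⟪W k σ, tableA α (W (k - 1) σ)⟫
        - 2 * (bigLam ε₀)⁻¹ * ⟪W (k + 1) σ, tableA α (W k σ)⟫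
        - 2 * viscCoef ε₀ νh k σ * ‖W k σ‖ ^ 2)
      ≤ Real.exp (2 * σ) * (2 * bigLam ε₀ * (‖W k σ‖ * (fluxConst α * ‖W (k - 1) σ‖ ^ 2))
        + 2 * (bigLam ε₀)⁻¹ * (‖W (k + 1) σ‖ * (fluxConst α * ‖W k σ‖ ^ 2))) :=
        mul_le_mul_of_nonneg_left (by linarith) hexp.le
    _ = 2 * (Real.exp σ * ‖W k σ‖) * (bigLam ε₀ * fluxConst α * (Real.exp σ * ‖W (k - 1) σ‖ ^ 2))
        + 2 * (fluxConst α * (bigLam ε₀)⁻¹) * ‖W (k + 1) σ‖ * (Real.exp σ * ‖W k σ‖) ^ 2 := by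
        rw [hexp2]; ring

/-- **THE FED-SPIKE INEQUALITY (Grönwall form, past-local).**  On a cancelling table, for every
admissible eternal solution with covariant viscosity `ν̂ ≥ 0` (`IsEternalVisc`), every shell `k` and
all log-times `a ≤ b`:
`e^{b}‖W_k(b)‖ ≤ exp(C_A Λ⁻¹ ∫_a^b ‖W_{k+1}‖) · (e^{a}‖W_k(a)‖ + Λ C_A ∫_a^b e^{s}‖W_{k-1}(s)‖² ds)`.
Mechanism: `renE_deriv_le` + the Grönwall fence `gronwall_sq_fence` for `ẽ_k = (e^{σ}‖W_k‖)²`.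
This is the rigorous content of the «fed spike» lever of the crux `WakeRatchet.AdmissibleEternalBound`
(stmt-23197): a shell is tall at `b` only if the shell BELOW carried a large `∫ e^{s}‖W_{k-1}‖²`
before `b` (up to the harmless Grönwall factor of the back-reaction, bounded by the action).
MODEL lattice ODEs only; nothing about the Navier–Stokes equations.
[cite: Tao2016AveragedNS, §4 Lemma 4.1 (4.8)–(4.10) with the cancellation (4.3), shell-wise in the self-similar variables of §6.4; cell vocabulary (`IsEternalVisc`)] -/
theorem fedSpike (hε : 0 < ε₀) (hc : IsCancellingCoeff α) (hW : IsEternalVisc ε₀ νh α W)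
    (k : ℤ) {a b : ℝ} (hab : a ≤ b) :
    Real.exp b * ‖W k b‖ ≤
      Real.exp (fluxConst α * (bigLam ε₀)⁻¹ * ∫ s in a..b, ‖W (k + 1) s‖) *
        (Real.exp a * ‖W k a‖ +
          ∫ s in a..b, bigLam ε₀ * fluxConst α * (Real.exp s * ‖W (k - 1) s‖ ^ 2)) := by
  have hS := table_sTable α hc
  have hΛpos : 0 < bigLam ε₀ := bigLam_pos (by linarith)
  have hκ : 0 ≤ fluxConst α * (bigLam ε₀)⁻¹ := mul_nonneg hS.CA_nonneg (inv_nonneg.2 hΛpos.le)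
  have hWc : ∀ n : ℤ, Continuous (W n) := fun n =>
    continuous_iff_continuousAt.2 fun x => (hW.law n x).continuousAt
  have hWk := hWc k
  have hWkm := hWc (k - 1)
  have hWkp := hWc (k + 1)
  have hexp2 : ∀ x : ℝ, Real.exp (2 * x) = Real.exp x * Real.exp x := fun x => by
    rw [show (2 : ℝ) * x = x + x by ring, Real.exp_add]
  have hE : ∀ x, HasDerivAt (fun x => (Real.exp x * ‖W k x‖) ^ 2)
      (Real.exp (2 * x) * (2 * bigLam ε₀ * ⟪W k x, tableA α (W (k - 1) x)⟫
        - 2 * (bigLam ε₀)⁻¹ * ⟪W (k + 1) x, tableA α (W k x)⟫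
        - 2 * viscCoef ε₀ νh k x * ‖W k x‖ ^ 2)) x := by
    intro x
    have h := hasDerivAt_renE hW hc k x
    have hfun : (fun x => Real.exp (2 * x) * ‖W k x‖ ^ 2) = fun x => (Real.exp x * ‖W k x‖) ^ 2 := by
      funext x; rw [hexp2 x]; ring
    rw [hfun] at h
    exact h
  have hsrc_c : Continuous fun s => bigLam ε₀ * fluxConst α * (Real.exp s * ‖W (k - 1) s‖ ^ 2) := by
    fun_prop
  have hcof_c : Continuous fun s => ‖W (k + 1) s‖ := by fun_prop
  have hCA := hS.CA_nonneg
  exact gronwall_sq_fence (h := fun x => Real.exp x * ‖W k x‖) hab hκ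
    (fun x => by positivity) hE (fun x => renE_deriv_le hε hc hW k x) hsrc_c hcof_c
    (fun s => by positivity) (fun s => norm_nonneg _)

end FedSpike

/-! ## The shell step on left half-lines and its iterate -/

section ShellStep

variable {m : ℕ} {ε₀ νh : ℝ} {α : Fin m → Fin m → Fin m → ℤ × ℤ × ℤ → ℝ} {W : ℤ → ℝ → Em m}

/-- **SHELL STEP on left half-lines («no spike without a comparable spike one shell below,
earlier»).**  On a cancelling table, for an admissible eternal solution (any `ν̂ ≥ 0`) with per-shell
action `∫‖W_n‖ ≤ M`: if `‖W_k‖ ≤ S` on `(-∞, σ₀]`, then `‖W_{k+1}‖ ≤ K · S` on `(-∞, σ₀]` with the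
FED-SPIKE FACTOR `K = Λ C_A M e^{C_A M/Λ}`.  Proof: `fedSpike` on `[a, σ]` with `a → -∞` along points
where `‖W_{k+1}(a)‖` is small (integrability), `∫_a^σ e^{s}‖W_k‖² ≤ e^{σ} S M` and `∫_a^σ ‖W_{k+2}‖ ≤ M`.
The factor `K` exceeds `1` unless the action is small — the precise form of the objection «feeder
heights decrease geometrically» (critic P1 on stmt-23197): the lever bounds shell `k+1` by shell `k`,
never uniformly in the shell index by itself.
[cite: Tao2016AveragedNS, §4 Lemma 4.1 (4.8)–(4.10) with (4.3), self-similar variables of §6.4; cell vocabulary (`IsEternalVisc`)] -/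
theorem shellStep (hε : 0 < ε₀) (hc : IsCancellingCoeff α) (hW : IsEternalVisc ε₀ νh α W)
    {M : ℝ} (hM : ∀ n : ℤ, Integrable (fun σ => ‖W n σ‖) ∧ ∫ σ, ‖W n σ‖ ≤ M)
    (k : ℤ) {σ₀ S : ℝ} (hS0 : 0 ≤ S) (hS : ∀ s, s ≤ σ₀ → ‖W k s‖ ≤ S) :
    ∀ σ, σ ≤ σ₀ → ‖W (k + 1) σ‖ ≤
      bigLam ε₀ * fluxConst α * M * Real.exp (fluxConst α * (bigLam ε₀)⁻¹ * M) * S := by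
  intro σ hσ
  have hS' := table_sTable α hc
  have hΛpos : 0 < bigLam ε₀ := bigLam_pos (by linarith)
  have hΛi : 0 ≤ (bigLam ε₀)⁻¹ := inv_nonneg.2 hΛpos.le
  have hCA : 0 ≤ fluxConst α := hS'.CA_nonneg
  have hM0 : 0 ≤ M := le_trans (integral_nonneg fun _ => norm_nonneg _) (hM 0).2
  have hWc : ∀ n : ℤ, Continuous (W n) := fun n =>
    continuous_iff_continuousAt.2 fun x => (hW.law n x).continuousAt
  set G : ℝ := Real.exp (fluxConst α * (bigLam ε₀)⁻¹ * M) with hGdef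
  have hG1 : 1 ≤ G := Real.one_le_exp (by positivity)
  refine le_of_forall_pos_lt_add fun η hη => ?_
  -- a far-left point where shell `k+1` is small
  obtain ⟨a, haσ, ha⟩ := exists_le_abs_lt (hM (k + 1)).1 (show 0 < η / (2 * G) by positivity) σ
  rw [abs_of_nonneg (norm_nonneg _)] at ha
  have hfs := fedSpike hε hc hW (k + 1) haσ
  rw [add_sub_cancel_right] at hfs
  -- the Grönwall factor is at most `G`
  have hI : ∫ s in a..σ, ‖W (k + 1 + 1) s‖ ≤ M :=
    (intervalIntegral_le_integral (hM (k + 1 + 1)).1 (fun _ => norm_nonneg _) haσ).trans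
      (hM (k + 1 + 1)).2
  have hexpG : Real.exp (fluxConst α * (bigLam ε₀)⁻¹ * ∫ s in a..σ, ‖W (k + 1 + 1) s‖) ≤ G :=
    Real.exp_le_exp.2 (mul_le_mul_of_nonneg_left hI (by positivity))
  -- the feed integral is at most `Λ C_A e^{σ} S M`
  have hfeed : ∫ s in a..σ, bigLam ε₀ * fluxConst α * (Real.exp s * ‖W k s‖ ^ 2)
      ≤ bigLam ε₀ * fluxConst α * (Real.exp σ * S * M) := by
    have hWk := hWc k
    have h1 : ∫ s in a..σ, bigLam ε₀ * fluxConst α * (Real.exp s * ‖W k s‖ ^ 2)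
        ≤ ∫ s in a..σ, (bigLam ε₀ * fluxConst α * (Real.exp σ * S)) * ‖W k s‖ := by
      refine intervalIntegral.integral_mono_on haσ ((by fun_prop : Continuous fun s =>
          bigLam ε₀ * fluxConst α * (Real.exp s * ‖W k s‖ ^ 2)).intervalIntegrable _ _)
        ((by fun_prop : Continuous fun s =>
          (bigLam ε₀ * fluxConst α * (Real.exp σ * S)) * ‖W k s‖).intervalIntegrable _ _) ?_
      intro s hs
      have hes : Real.exp s ≤ Real.exp σ := Real.exp_le_exp.2 hs.2
      have hWs : ‖W k s‖ ≤ S := hS s (hs.2.trans hσ)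
      have hn : 0 ≤ ‖W k s‖ := norm_nonneg _
      have : Real.exp s * ‖W k s‖ ^ 2 ≤ Real.exp σ * S * ‖W k s‖ := by
        rw [sq]
        calc Real.exp s * (‖W k s‖ * ‖W k s‖) = Real.exp s * ‖W k s‖ * ‖W k s‖ := by ring
          _ ≤ Real.exp σ * S * ‖W k s‖ :=
            mul_le_mul_of_nonneg_right (mul_le_mul hes hWs hn (Real.exp_pos _).le) hn
      calc bigLam ε₀ * fluxConst α * (Real.exp s * ‖W k s‖ ^ 2)
          ≤ bigLam ε₀ * fluxConst α * (Real.exp σ * S * ‖W k s‖) :=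
            mul_le_mul_of_nonneg_left this (by positivity)
        _ = bigLam ε₀ * fluxConst α * (Real.exp σ * S) * ‖W k s‖ := by ring
    have h2 : ∫ s in a..σ, (bigLam ε₀ * fluxConst α * (Real.exp σ * S)) * ‖W k s‖
        = (bigLam ε₀ * fluxConst α * (Real.exp σ * S)) * ∫ s in a..σ, ‖W k s‖ :=
      intervalIntegral.integral_const_mul _ _
    have h3 : ∫ s in a..σ, ‖W k s‖ ≤ M :=
      (intervalIntegral_le_integral (hM k).1 (fun _ => norm_nonneg _) haσ).trans (hM k).2
    calc ∫ s in a..σ, bigLam ε₀ * fluxConst α * (Real.exp s * ‖W k s‖ ^ 2)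
        ≤ (bigLam ε₀ * fluxConst α * (Real.exp σ * S)) * ∫ s in a..σ, ‖W k s‖ := by rw [← h2]; exact h1
      _ ≤ (bigLam ε₀ * fluxConst α * (Real.exp σ * S)) * M :=
          mul_le_mul_of_nonneg_left h3 (by positivity)
      _ = bigLam ε₀ * fluxConst α * (Real.exp σ * S * M) := by ring
  -- the initial term is at most `e^{σ} η/(2G)`
  have hinit : Real.exp a * ‖W (k + 1) a‖ ≤ Real.exp σ * (η / (2 * G)) :=
    mul_le_mul (Real.exp_le_exp.2 haσ) ha.le (norm_nonneg _) (Real.exp_pos _).le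
  have hsum : Real.exp a * ‖W (k + 1) a‖
        + ∫ s in a..σ, bigLam ε₀ * fluxConst α * (Real.exp s * ‖W k s‖ ^ 2)
      ≤ Real.exp σ * (η / (2 * G) + bigLam ε₀ * fluxConst α * S * M) := by
    have := add_le_add hinit hfeed
    linarith
  have hsum0 : 0 ≤ Real.exp a * ‖W (k + 1) a‖
        + ∫ s in a..σ, bigLam ε₀ * fluxConst α * (Real.exp s * ‖W k s‖ ^ 2) := by
    have : 0 ≤ ∫ s in a..σ, bigLam ε₀ * fluxConst α * (Real.exp s * ‖W k s‖ ^ 2) :=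
      intervalIntegral.integral_nonneg haσ fun s _ => by positivity
    positivity
  have hmain : Real.exp σ * ‖W (k + 1) σ‖
      ≤ G * (Real.exp σ * (η / (2 * G) + bigLam ε₀ * fluxConst α * S * M)) :=
    hfs.trans (mul_le_mul hexpG hsum hsum0 (by positivity))
  have hexpσ : 0 < Real.exp σ := Real.exp_pos _
  have hdiv : ‖W (k + 1) σ‖ ≤ G * (η / (2 * G) + bigLam ε₀ * fluxConst α * S * M) := by
    have : Real.exp σ * ‖W (k + 1) σ‖
        ≤ Real.exp σ * (G * (η / (2 * G) + bigLam ε₀ * fluxConst α * S * M)) := by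
      calc _ ≤ G * (Real.exp σ * (η / (2 * G) + bigLam ε₀ * fluxConst α * S * M)) := hmain
        _ = _ := by ring
    exact le_of_mul_le_mul_left this hexpσ
  have hGη : G * (η / (2 * G)) = η / 2 := by
    field_simp
  calc ‖W (k + 1) σ‖ ≤ G * (η / (2 * G) + bigLam ε₀ * fluxConst α * S * M) := hdiv
    _ = η / 2 + bigLam ε₀ * fluxConst α * M * G * S := by rw [mul_add, hGη]; ring
    _ < bigLam ε₀ * fluxConst α * M * G * S + η := by linarith

end ShellStep

end WakeRatchetFedSpike

end Summit.NavierStokesRegularity.NavierStokesRegularity.Theorems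

end
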